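import Summits.Langlands.Langlands.Theses.ParityBlindBianchi
import Summits.Langlands.Langlands.Theorems.ParityBlindBianchiTwoAdicBianchiProModularityLevelStubUniformizer
import Summits.Langlands.Langlands.Theorems.ParityBlindBianchiTwoAdicBianchiProModularityLevelReduction
import Summits.Langlands.Langlands.Theorems.ParityBlindBianchiTwoAdicBianchiProModularityLevelStubCongrDictionary
import Literature.NumberTheory.Automorphic.RegularAlgebraicCuspidalHeckePoint
import HarnessLib

/-!
# `TwoAdicBianchiProModularityLevel` (stmt-Langlands-15110) — the BRIDGE: crux ⇐ A ∧ B

Item `Summit.Langlands.Langlands.Theses.ParityBlindBianchi.TwoAdicBianchiProModularityLevel` (E2′ of route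
ParityBlindBianchi: a residually automorphic icosahedral finite-image `σ : Γ_K → GL₂(ℚ̄₂)` over a `2`-split
imaginary quadratic `K` is a continuous `𝒪_{ℚ̄₂}`-point of the big Hecke algebra `𝕋(U²)` of the `2`-power
Bianchi tower, Hansen-associated with `σ` off `S₀`).  This file lands, sorry-free, the composition of the line
`Sketch` (`Cruxes/TwoAdicBianchiProModularityLevel/Lines/Sketch.lean`) with its two remaining stubs turned
into explicit hypotheses, so that the crux is recorded in the tree as the conjunction of exactly two
named pieces of mathematics:

* (A) the AUTOMORPHIC-TO-COHOMOLOGY TRANSPORT `hA` — a regular algebraic cuspidal `π₀` of `GL₂(𝔸_K)`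
  unramified off `S₀ ∋ 2` is an integral point `b` of `Spf 𝕋(U₀²)` at a tame level `U₀` hyperspecial off
  `S₀`, with the Satake–Tamagawa eigenvalues (theorem in print: Eichler–Shimura–Harder + Scholze §V.4 /
  Emerton; the registered stub `stub_classicalHeckePoint`, which is the case `p = 2` of the Literature
  named fact `bianchi_regularAlgebraicCuspidal_isHeckePoint`, unproved in the tree);
* (B) the ARTIN LIFT `hB` — if the residual eigensystem of `σ` occurs in `𝕋(U₀²)` (an `𝒪`-point
  `b ≡ a (mod 𝔪)` at every good place, `a` = Hansen data of `σ`), then `a` itself is a point of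
  `Spf 𝕋(U²)` for some tame level `U` hyperspecial off `S₀`: big `R = 𝕋` for `GL₂/K` in defect `l₀ = 1`
  at `p = 2`, read at the Artin point (the registered stub `stub_artinLift`; OPEN PROBLEM —
  Gee–Newton Conj. 60 / Prop. 62, Calegari–Geraghty Thm. 1.1, Hansen Conj. 1.2.3 — to be filed by the
  planner as the `@[conjecture]` layer-2 item of the route's two-layer plan).

`TwoAdicBianchiProModularityLevel_of_classicalPoint_artinLift : A → B → crux` uses the landed stubs
`stub_uniformizer` (p96237), `stub_heckeData` / `heckeFrobPoly_two` / `exists_pow_eq_one_of_finite_range`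
(p98537), `stub_charpolyInv` (p96257), `stub_residueCardNorm` (p96340) and the rank-two congruence dictionary
`stub_congrDictionary` (p104947); `TwoAdicBianchiProModularityLevel_of_artinLift : fact → B → crux`
specialises the Literature fact to `p = 2`.  When B lands (as a theorem or as a route item `X_B` with
`X_B_holds`), the closing file of the crux is `TwoAdicBianchiProModularityLevel_of_artinLift ‹fact› ‹B›`.
-/

noncomputable section

set_option linter.dupNamespace false -- `Summit.Langlands.Langlands` is the mandated namespace (D-0017)

open scoped NumberField MatrixGroups
open Polynomial IsDedekindDomain Field
open Literature.NumberTheory.GaloisRepresentations Literature.NumberTheory.Automorphic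

namespace Summit.Langlands.Langlands.Theorems.TwoAdicBianchiProModularityLevel

/-- **The bridge `crux ⇐ A ∧ B`.**  If (A) every regular algebraic cuspidal `π₀` of `GL₂(𝔸_K)` over an
imaginary quadratic `K`, unramified off `S₀ ∋ 2`, is an integral point `b` of the big Hecke algebra of the
`2`-power Bianchi tower at some tame level `U₀` hyperspecial off `S₀` with `ι(b_{v,1}) = q_v^{1/2} e₁(α_v)`,
`ι(b_{v,2}) = e₂(α_v)` (Eichler–Shimura–Harder + Scholze §V.4; the registered stub `stub_classicalHeckePoint`
verbatim), and (B) residual occurrence of the Hansen data `a` of an icosahedral finite-image `σ` in some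
`𝕋(U₀²)` implies that `a` is a point of some `𝕋(U²)`, `U` hyperspecial off `S₀` (big `R = 𝕋` for `GL₂/K`,
`l₀ = 1`, `p = 2`, at the Artin point; the registered stub `stub_artinLift` verbatim), then
`TwoAdicBianchiProModularityLevel` holds.  Proof: uniformisers from `stub_uniformizer`; `a_{v,1} = tr/det`,
`a_{v,2} = 1/(q_v det)` of `σ(Frob_v)`, integral and Hansen-associated, from `stub_heckeData`; the classical
point `(U₀, b)` from (A); `‖b − a‖ < 1` at every good place from the residual-automorphy congruence through
the rank-two dictionary `stub_congrDictionary`, evaluated at an arithmetic Frobenius (`primesAbove_nonempty`,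
`exists_isArithFrobAt_of_mem_primesAbove_holds`), using `charpoly σ(g)⁻¹ = X² − (tr/det) X + 1/det`
(`stub_charpolyInv`), `σ(g)^N = 1` (`exists_pow_eq_one_of_finite_range`) and `‖q_v‖ = 1` (`stub_residueCardNorm`);
then `U` and the Hecke point of `a` from (B). [cite: GeeNewton2020, §5.1, Conj. 60 and Prop. 62]
[cite: Scholze2015, §V.4, Thm. V.4.1] -/
theorem TwoAdicBianchiProModularityLevel_of_classicalPoint_artinLift
    (hA : ∀ (K : Type) [Field K] [NumberField K], NumberField.IsTotallyComplex K →
      Module.finrank ℚ K = 2 →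
      ∀ (ι : PadicAlgCl 2 ≃+* ℂ) (hcpt : isCompact_glFiniteIntegralLevel 2 K)
      (π₀ : CuspidalAutomorphicRepData 2 K hcpt), π₀.1.IsRegularAlgebraic →
      ∀ S₀ : Finset ℕ, 2 ∈ S₀ →
      (∀ v : HeightOneSpectrum (𝓞 K), (∀ ℓ ∈ S₀, ((ℓ : ℕ) : 𝓞 K) ∉ v.asIdeal) → π₀.1.IsUnramifiedAt v) →
      ∃ U₀ : Subgroup (GL (Fin 2) (FiniteAdeleRing (𝓞 K) K)),
      IsOpen (U₀ : Set (GL (Fin 2) (FiniteAdeleRing (𝓞 K) K))) ∧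
      U₀ ≤ glFiniteIntegralLevel 2 K ∧
      (∀ g ∈ glFiniteIntegralLevel 2 K,
      (∀ v : HeightOneSpectrum (𝓞 K), ¬ (∀ ℓ ∈ S₀, ((ℓ : ℕ) : 𝓞 K) ∉ v.asIdeal) →
      ∀ i j : Fin 2, ((g : Matrix (Fin 2) (Fin 2) (FiniteAdeleRing (𝓞 K) K)) i j) v =
      (1 : Matrix (Fin 2) (Fin 2) (v.adicCompletion K)) i j) → g ∈ U₀) ∧
      ∀ (ϖ : ∀ v : HeightOneSpectrum (𝓞 K), (v.adicCompletion K)ˣ),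
      (∀ v : HeightOneSpectrum (𝓞 K),
      Valued.v ((ϖ v : (v.adicCompletion K)ˣ) : v.adicCompletion K) = WithZero.exp (-1 : ℤ)) →
      ∃ b : {v : HeightOneSpectrum (𝓞 K) // ∀ ℓ ∈ S₀, ((ℓ : ℕ) : 𝓞 K) ∉ v.asIdeal} → ℕ →
      (PadicAlgCl.valued 2).v.valuationSubring,
      (∀ (v : HeightOneSpectrum (𝓞 K)) (hv : ∀ ℓ ∈ S₀, ((ℓ : ℕ) : 𝓞 K) ∉ v.asIdeal)
      (α : Multiset ℂ), π₀.1.HasSatakeParamAt v α →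
      ι ((b ⟨v, hv⟩ 1 : (PadicAlgCl.valued 2).v.valuationSubring) : PadicAlgCl 2) =
      (((Real.sqrt (v.residueCard : ℝ) : ℝ) : ℂ)) * α.esymm 1 ∧
      ι ((b ⟨v, hv⟩ 2 : (PadicAlgCl.valued 2).v.valuationSubring) : PadicAlgCl 2) =
      α.esymm 2) ∧
      IsHeckePoint
      (Matrix.GeneralLinearGroup.map (algebraMap K (FiniteAdeleRing (𝓞 K) K)) :
      GL (Fin 2) K →* GL (Fin 2) (FiniteAdeleRing (𝓞 K) K))
      (LevelTower.ofSeq U₀ (fun r : ℕ =>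
      (principalCongruenceLevel 2 K (Ideal.span {((2 : ℕ) : 𝓞 K)} ^ r)).map (GLn.sndHom 2 K)))
      ((2 : ℕ) : (PadicAlgCl.valued 2).v.valuationSubring)
      (fun j : {v : HeightOneSpectrum (𝓞 K) // ∀ ℓ ∈ S₀, ((ℓ : ℕ) : 𝓞 K) ∉ v.asIdeal} × Fin 2 =>
      GLn.sndHom 2 K (heckeDiagAt 2 K j.1.1 (ϖ j.1.1) (j.2.val + 1)))
      (fun j => b j.1 (j.2.val + 1)))
    (hB : ∀ (K : Type) [Field K] [NumberField K], NumberField.IsTotallyComplex K →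
      Module.finrank ℚ K = 2 →
      (∃ v w : HeightOneSpectrum (𝓞 K), v ≠ w ∧ ((2 : ℕ) : 𝓞 K) ∈ v.asIdeal ∧
      ((2 : ℕ) : 𝓞 K) ∈ w.asIdeal) →
      ∀ (σ : FramedGaloisRep K (PadicAlgCl 2) 2),
      Finite σ.toMonoidHom.range → σ.toGaloisRep.IsIrreducible →
      Nonempty ((Matrix.ProjGenLinGroup.mk.comp σ.toMonoidHom).range ≃* alternatingGroup (Fin 5)) →
      ∀ S₀ : Finset ℕ, 2 ∈ S₀ →
      ∀ (ϖ : ∀ v : HeightOneSpectrum (𝓞 K), (v.adicCompletion K)ˣ),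
      (∀ v : HeightOneSpectrum (𝓞 K),
      Valued.v ((ϖ v : (v.adicCompletion K)ˣ) : v.adicCompletion K) = WithZero.exp (-1 : ℤ)) →
      ∀ (a : {v : HeightOneSpectrum (𝓞 K) // ∀ ℓ ∈ S₀, ((ℓ : ℕ) : 𝓞 K) ∉ v.asIdeal} → ℕ →
      (PadicAlgCl.valued 2).v.valuationSubring),
      (∀ (v : HeightOneSpectrum (𝓞 K)) (hv : ∀ ℓ ∈ S₀, ((ℓ : ℕ) : 𝓞 K) ∉ v.asIdeal),
      σ.IsHeckeAssociatedAt v (fun i : ℕ => if i = 0 then (1 : PadicAlgCl 2) else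
      ((a ⟨v, hv⟩ i : (PadicAlgCl.valued 2).v.valuationSubring) : PadicAlgCl 2))) →
      (∃ U₀ : Subgroup (GL (Fin 2) (FiniteAdeleRing (𝓞 K) K)),
      IsOpen (U₀ : Set (GL (Fin 2) (FiniteAdeleRing (𝓞 K) K))) ∧
      U₀ ≤ glFiniteIntegralLevel 2 K ∧
      (∀ g ∈ glFiniteIntegralLevel 2 K,
      (∀ v : HeightOneSpectrum (𝓞 K), ¬ (∀ ℓ ∈ S₀, ((ℓ : ℕ) : 𝓞 K) ∉ v.asIdeal) →
      ∀ i j : Fin 2, ((g : Matrix (Fin 2) (Fin 2) (FiniteAdeleRing (𝓞 K) K)) i j) v =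
      (1 : Matrix (Fin 2) (Fin 2) (v.adicCompletion K)) i j) → g ∈ U₀) ∧
      ∃ b : {v : HeightOneSpectrum (𝓞 K) // ∀ ℓ ∈ S₀, ((ℓ : ℕ) : 𝓞 K) ∉ v.asIdeal} → ℕ →
      (PadicAlgCl.valued 2).v.valuationSubring,
      (∀ j : {v : HeightOneSpectrum (𝓞 K) // ∀ ℓ ∈ S₀, ((ℓ : ℕ) : 𝓞 K) ∉ v.asIdeal} × Fin 2,
      ‖((b j.1 (j.2.val + 1) : (PadicAlgCl.valued 2).v.valuationSubring) : PadicAlgCl 2) -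
      ((a j.1 (j.2.val + 1) : (PadicAlgCl.valued 2).v.valuationSubring) : PadicAlgCl 2)‖ < 1) ∧
      IsHeckePoint
      (Matrix.GeneralLinearGroup.map (algebraMap K (FiniteAdeleRing (𝓞 K) K)) :
      GL (Fin 2) K →* GL (Fin 2) (FiniteAdeleRing (𝓞 K) K))
      (LevelTower.ofSeq U₀ (fun r : ℕ =>
      (principalCongruenceLevel 2 K (Ideal.span {((2 : ℕ) : 𝓞 K)} ^ r)).map (GLn.sndHom 2 K)))
      ((2 : ℕ) : (PadicAlgCl.valued 2).v.valuationSubring)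
      (fun j : {v : HeightOneSpectrum (𝓞 K) // ∀ ℓ ∈ S₀, ((ℓ : ℕ) : 𝓞 K) ∉ v.asIdeal} × Fin 2 =>
      GLn.sndHom 2 K (heckeDiagAt 2 K j.1.1 (ϖ j.1.1) (j.2.val + 1)))
      (fun j => b j.1 (j.2.val + 1))) →
      ∃ U : Subgroup (GL (Fin 2) (FiniteAdeleRing (𝓞 K) K)),
      IsOpen (U : Set (GL (Fin 2) (FiniteAdeleRing (𝓞 K) K))) ∧
      U ≤ glFiniteIntegralLevel 2 K ∧
      (∀ g ∈ glFiniteIntegralLevel 2 K,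
      (∀ v : HeightOneSpectrum (𝓞 K), ¬ (∀ ℓ ∈ S₀, ((ℓ : ℕ) : 𝓞 K) ∉ v.asIdeal) →
      ∀ i j : Fin 2, ((g : Matrix (Fin 2) (Fin 2) (FiniteAdeleRing (𝓞 K) K)) i j) v =
      (1 : Matrix (Fin 2) (Fin 2) (v.adicCompletion K)) i j) → g ∈ U) ∧
      IsHeckePoint
      (Matrix.GeneralLinearGroup.map (algebraMap K (FiniteAdeleRing (𝓞 K) K)) :
      GL (Fin 2) K →* GL (Fin 2) (FiniteAdeleRing (𝓞 K) K))
      (LevelTower.ofSeq U (fun r : ℕ =>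
      (principalCongruenceLevel 2 K (Ideal.span {((2 : ℕ) : 𝓞 K)} ^ r)).map (GLn.sndHom 2 K)))
      ((2 : ℕ) : (PadicAlgCl.valued 2).v.valuationSubring)
      (fun j : {v : HeightOneSpectrum (𝓞 K) // ∀ ℓ ∈ S₀, ((ℓ : ℕ) : 𝓞 K) ∉ v.asIdeal} × Fin 2 =>
      GLn.sndHom 2 K (heckeDiagAt 2 K j.1.1 (ϖ j.1.1) (j.2.val + 1)))
      (fun j => a j.1 (j.2.val + 1))) :
    Summit.Langlands.Langlands.Theses.ParityBlindBianchi.TwoAdicBianchiProModularityLevel := by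
  intro K _ _ htc hdeg hsplit ι σ hfin hirr hA5 S₀ h2 hres
  -- uniformisers
  choose ϖ hϖ using stub_uniformizer K
  obtain ⟨hcpt, π₀, hreg, hg⟩ := hres
  -- the Galois half: integral Hecke data associated with σ at the good places
  have hgood : ∀ v : HeightOneSpectrum (𝓞 K), (∀ ℓ ∈ S₀, ((ℓ : ℕ) : 𝓞 K) ∉ v.asIdeal) →
      σ.IsUnramifiedAt v ∧ ∃ P : Polynomial (PadicAlgCl 2), σ.HasFrobCharpolyAt v P := by
    intro v hv
    obtain ⟨α, P, -, hur, hPv, -⟩ := hg v hv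
    exact ⟨hur, P, hPv⟩
  obtain ⟨a, hassoc⟩ := stub_heckeData K σ hfin S₀ h2 hgood
  -- (A-raw) the classical point of the cohomological π₀
  have hunr : ∀ v : HeightOneSpectrum (𝓞 K), (∀ ℓ ∈ S₀, ((ℓ : ℕ) : 𝓞 K) ∉ v.asIdeal) →
      π₀.1.IsUnramifiedAt v := by
    intro v hv
    obtain ⟨α, P, hSat, -, -, -⟩ := hg v hv
    exact ⟨α, hSat⟩
  obtain ⟨U₀, hU₀o, hU₀le, hU₀3, hb⟩ :=
    hA K htc hdeg ι hcpt π₀ hreg S₀ h2 hunr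
  obtain ⟨b, hbval, hbpt⟩ := hb ϖ hϖ
  -- (A-glue) the classical point is congruent to the Hansen data of σ at every good place
  have hcongr : ∀ j : {v : HeightOneSpectrum (𝓞 K) // ∀ ℓ ∈ S₀, ((ℓ : ℕ) : 𝓞 K) ∉ v.asIdeal} × Fin 2,
      ‖((b j.1 (j.2.val + 1) : (PadicAlgCl.valued 2).v.valuationSubring) : PadicAlgCl 2) -
        ((a j.1 (j.2.val + 1) : (PadicAlgCl.valued 2).v.valuationSubring) : PadicAlgCl 2)‖ < 1 := by
    rintro ⟨⟨v, hv⟩, k⟩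
    obtain ⟨α, P, hSat, -, hPv, hcg⟩ := hg v hv
    -- an arithmetic Frobenius at v
    obtain ⟨𝔓, h𝔓⟩ := HeightOneSpectrum.primesAbove_nonempty v
    obtain ⟨g, hgF⟩ := HeightOneSpectrum.exists_isArithFrobAt_of_mem_primesAbove_holds (v := v) h𝔓
    set M : Matrix (Fin 2) (Fin 2) (PadicAlgCl 2) := ((σ g : GL (Fin 2) (PadicAlgCl 2)) :
      Matrix (Fin 2) (Fin 2) (PadicAlgCl 2)) with hM
    have hcp : M.charpoly = P := hPv 𝔓 h𝔓 g hgF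
    -- finite order
    obtain ⟨N, hN, hgN⟩ := exists_pow_eq_one_of_finite_range σ.toMonoidHom hfin g
    have hMN : M ^ N = 1 := by
      have := congrArg (fun u : GL (Fin 2) (PadicAlgCl 2) =>
        (u : Matrix (Fin 2) (Fin 2) (PadicAlgCl 2))) hgN
      simpa [hM, Units.val_pow_eq_pow_val] using this
    -- Hansen's normalisation of a: charpoly σ(g⁻¹) = X² − a₁ X + q a₂, and charpoly of the inverse
    have hinv : FramedRep.charpoly σ g⁻¹ = X ^ 2 - C (M.trace * M.det⁻¹) * X + C M.det⁻¹ := by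
      rw [FramedRep.charpoly, map_inv]
      exact stub_charpolyInv (PadicAlgCl 2) (σ g)
    have hass := (hassoc v hv).2 𝔓 h𝔓 g hgF
    rw [hinv, heckeFrobPoly_two _ _ (by simp)] at hass
    simp only [show (1 : ℕ) ≠ 0 by decide, show (2 : ℕ) ≠ 0 by decide, if_false] at hass
    have hq1 : ‖((v.residueCard : ℕ) : PadicAlgCl 2)‖ = 1 := stub_residueCardNorm K v (hv 2 h2)
    have hcg' : ∀ i : ℕ, ‖M.charpoly.coeff i - (arithFrobPolyOfSatake ι v.residueCard 2 α).coeff i‖ < 1 := by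
      rw [hcp]; exact hcg
    obtain ⟨h1, h2'⟩ := stub_congrDictionary ι v.residueCard hq1 M N hN hMN α hSat.card_eq hcg'
      _ _ _ _ hass (hbval v hv α hSat).1 (hbval v hv α hSat).2
    fin_cases k
    · exact h1
    · exact h2'
  -- (B) big R = 𝕋 at the Artin point: tame level and Hecke point of a
  obtain ⟨U, hUo, hUle, hU3, hpt⟩ :=
    hB K htc hdeg hsplit σ hfin hirr hA5 S₀ h2 ϖ hϖ a hassoc
      ⟨U₀, hU₀o, hU₀le, hU₀3, b, hcongr, hbpt⟩
  exact ⟨U, ϖ, a, hUo, hUle, hU3, hϖ, hpt, hassoc⟩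

/-- **The bridge, modulo the Literature named fact**: `bianchi_regularAlgebraicCuspidal_isHeckePoint`
(Eichler–Shimura–Harder + Scholze §V.4, unproved in the tree; users take it as a hypothesis) specialised
to `p = 2` is hypothesis (A) of `TwoAdicBianchiProModularityLevel_of_classicalPoint_artinLift`, so the crux
`TwoAdicBianchiProModularityLevel` follows from that fact and (B) = `stub_artinLift` (big `R = 𝕋` for
`GL₂/K`, `l₀ = 1`, `p = 2`, read at the Artin point — the open content).  This is the form in which E2′
becomes a bridge of the route's two-layer plan. [cite: Scholze2015, §V.4, Thm. V.4.1 and proof of Cor. V.4.2]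
[cite: GeeNewton2020, §5.1, Conj. 60 and Prop. 62] -/
theorem TwoAdicBianchiProModularityLevel_of_artinLift : Literature.NumberTheory.Automorphic.bianchi_regularAlgebraicCuspidal_isHeckePoint → (∀ (K : Type) [Field K] [NumberField K], NumberField.IsTotallyComplex K → Module.finrank ℚ K = 2 → (∃ v w : HeightOneSpectrum (𝓞 K), v ≠ w ∧ ((2 : ℕ) : 𝓞 K) ∈ v.asIdeal ∧ ((2 : ℕ) : 𝓞 K) ∈ w.asIdeal) → ∀ (σ : FramedGaloisRep K (PadicAlgCl 2) 2), Finite σ.toMonoidHom.range → σ.toGaloisRep.IsIrreducible → Nonempty ((Matrix.ProjGenLinGroup.mk.comp σ.toMonoidHom).range ≃* alternatingGroup (Fin 5)) → ∀ S₀ : Finset ℕ, 2 ∈ S₀ → ∀ (ϖ : ∀ v : HeightOneSpectrum (𝓞 K), (v.adicCompletion K)ˣ), (∀ v : HeightOneSpectrum (𝓞 K), Valued.v ((ϖ v : (v.adicCompletion K)ˣ) : v.adicCompletion K) = WithZero.exp (-1 : ℤ)) → ∀ (a : {v : HeightOneSpectrum (𝓞 K) // ∀ ℓ ∈ S₀,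 ((ℓ : ℕ) : 𝓞 K) ∉ v.asIdeal} → ℕ → (PadicAlgCl.valued 2).v.valuationSubring), (∀ (v : HeightOneSpectrum (𝓞 K)) (hv : ∀ ℓ ∈ S₀, ((ℓ : ℕ) : 𝓞 K) ∉ v.asIdeal), σ.IsHeckeAssociatedAt v (fun i : ℕ => if i = 0 then (1 : PadicAlgCl 2) else ((a ⟨v, hv⟩ i : (PadicAlgCl.valued 2).v.valuationSubring) : PadicAlgCl 2))) → (∃ U₀ : Subgroup (GL (Fin 2) (FiniteAdeleRing (𝓞 K) K)), IsOpen (U₀ : Set (GL (Fin 2) (FiniteAdeleRing (𝓞 K) K))) ∧ U₀ ≤ glFiniteIntegralLevel 2 K ∧ (∀ g ∈ glFiniteIntegralLevel 2 K, (∀ v : HeightOneSpectrum (𝓞 K), ¬ (∀ ℓ ∈ S₀, ((ℓ : ℕ) : 𝓞 K) ∉ v.asIdeal) → ∀ i j : Fin 2, ((g : Matrix (Fin 2) (Fin 2) (FiniteAdeleRing (𝓞 K) K)) i j) v = (1 : Matrix (Fin 2) (Fin 2) (v.adicCompletion K)) i j) → g ∈ U₀) ∧ ∃ b : {v : HeightOneSpectrum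 (𝓞 K) // ∀ ℓ ∈ S₀, ((ℓ : ℕ) : 𝓞 K) ∉ v.asIdeal} → ℕ → (PadicAlgCl.valued 2).v.valuationSubring, (∀ j : {v : HeightOneSpectrum (𝓞 K) // ∀ ℓ ∈ S₀, ((ℓ : ℕ) : 𝓞 K) ∉ v.asIdeal} × Fin 2, ‖((b j.1 (j.2.val + 1) : (PadicAlgCl.valued 2).v.valuationSubring) : PadicAlgCl 2) - ((a j.1 (j.2.val + 1) : (PadicAlgCl.valued 2).v.valuationSubring) : PadicAlgCl 2)‖ < 1) ∧ IsHeckePoint (Matrix.GeneralLinearGroup.map (algebraMap K (FiniteAdeleRing (𝓞 K) K)) : GL (Fin 2) K →* GL (Fin 2) (FiniteAdeleRing (𝓞 K) K)) (LevelTower.ofSeq U₀ (fun r : ℕ => (principalCongruenceLevel 2 K (Ideal.span {((2 : ℕ) : 𝓞 K)} ^ r)).map (GLn.sndHom 2 K))) ((2 : ℕ) : (PadicAlgCl.valued 2).v.valuationSubring) (fun j : {v : HeightOneSpectrum (𝓞 K) // ∀ ℓ ∈ S₀, ((ℓ : ℕ) : 𝓞 K) ∉ v.asIdeal} × Fin 2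 => GLn.sndHom 2 K (heckeDiagAt 2 K j.1.1 (ϖ j.1.1) (j.2.val + 1))) (fun j => b j.1 (j.2.val + 1))) → ∃ U : Subgroup (GL (Fin 2) (FiniteAdeleRing (𝓞 K) K)), IsOpen (U : Set (GL (Fin 2) (FiniteAdeleRing (𝓞 K) K))) ∧ U ≤ glFiniteIntegralLevel 2 K ∧ (∀ g ∈ glFiniteIntegralLevel 2 K, (∀ v : HeightOneSpectrum (𝓞 K), ¬ (∀ ℓ ∈ S₀, ((ℓ : ℕ) : 𝓞 K) ∉ v.asIdeal) → ∀ i j : Fin 2, ((g : Matrix (Fin 2) (Fin 2) (FiniteAdeleRing (𝓞 K) K)) i j) v = (1 : Matrix (Fin 2) (Fin 2) (v.adicCompletion K)) i j) → g ∈ U) ∧ IsHeckePoint (Matrix.GeneralLinearGroup.map (algebraMap K (FiniteAdeleRing (𝓞 K) K)) : GL (Fin 2) K →* GL (Fin 2) (FiniteAdeleRing (𝓞 K) K)) (LevelTower.ofSeq U (fun r : ℕ => (principalCongruenceLevel 2 K (Ideal.span {((2 : ℕ) : 𝓞 K)} ^ r)).map (GLn.sndHom 2 K))) ((2 : ℕ)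 : (PadicAlgCl.valued 2).v.valuationSubring) (fun j : {v : HeightOneSpectrum (𝓞 K) // ∀ ℓ ∈ S₀, ((ℓ : ℕ) : 𝓞 K) ∉ v.asIdeal} × Fin 2 => GLn.sndHom 2 K (heckeDiagAt 2 K j.1.1 (ϖ j.1.1) (j.2.val + 1))) (fun j => a j.1 (j.2.val + 1))) → Summit.Langlands.Langlands.Theses.ParityBlindBianchi.TwoAdicBianchiProModularityLevel :=
  fun hX hB =>
  TwoAdicBianchiProModularityLevel_of_classicalPoint_artinLift
    (fun K _ _ htc hdeg ι hcpt π₀ hreg S₀ h2 hur => hX K htc hdeg 2 ι hcpt π₀ hreg S₀ h2 hur) hB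

end Summit.Langlands.Langlands.Theorems.TwoAdicBianchiProModularityLevel

end
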